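import Literature.MathematicalPhysics.QuantumLattice.DWaveSourceGSClassWindowCertificate
import Literature.MathematicalPhysics.QuantumLattice.CanonicalClassGroundStateRows
import HarnessLib

/-!
# Pair-sourced `t–t'` window certificates WITH ground-state rows on NUMBER-CONSERVING words, read in the
# CANONICAL CLASS (density-`ρ` minimisers of the sourced energy): the chemical potential drops out

Topic `Literature/MathematicalPhysics/QuantumLattice` (namespace = path); cell `hubbard-cq`, seat `hubbard-cq-obsth-1`
(row «pinning-field K5 menu nodes with the pinning term»). Companion of `DWaveSourceGSClassWindowCertificate` (the
grand-canonical ground-state class at a KNOWN `μ`) and `DWaveSourceTIClassWindowCertificate` (every translation-invariant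
state, no ground-state rows). The cell's CANONICAL sentences quantify over the density-`ρ` minimisers of
`e^{src}_{0,h}` («every translation-invariant `σ` of density `7/8` minimising the sourced energy among such states»,
`Certificates/…canonicalFloors…`); the canonical certificates carry FILLING rows and are written at `μ = 0`. Such a
minimiser is a Bratteli–Kishimoto–Robinson ground state of `Φ − μn − hP_d` for SOME (uncertified) chemical potential `μ`
(Ruelle's tangent + BKR Thm. 2, tree `exists_isGroundState_hubbardTTPrimeSourced_of_canonicalMinimiser`), and for
NUMBER-CONSERVING local words the commutator with `H^{src,μ}` does not see `μ`
(`hubbardTTPrimeSourcedInteraction_commutator_eq_of_commute`). Hence ground-state rows written with the `μ = 0` window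
Hamiltonian `H₀ = pairSourceWindowHamiltonianTT' dWaveFormFactor Λ' t' U 0 h` are licensed on the canonical class PROVIDED every
`eom` word `Bₖ` and every `kkt` generator `Bk_b` commutes with the particle number of its support (`Commute totalNumber B`;
engine: «neutral» / charge-0 words — exactly the «neutral degree ≤ 2 eom rows» of the cell's EE leg):

* §1 number-conserving words: `Commute N_Λ B → Commute N_{Λ'} (Γ B)`; `[H^{src}_{Λ'}(μ), B̃] = [H^{src}_{Λ'}(μ₀), B̃]`; for a ground
  state of `Φ − μn − hP_d` the rows `ω(H₀ B̃ − B̃ H₀) = 0`, `Re ω(Ã⋆(H₀ Ã − Ã H₀)) ≥ 0`, `0 ≤ Re ω(kktForm H₀ G B̃k)` with the window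
  Hamiltonian at ANY `μ₀` (here `μ₀ = 0`).
* §2 `IsTranslationInvariant.re_sum_twistedFlipAct_expect_ge_of_sourced_certificate_kkt_canonical` — the orbit form on the
  canonical class: the §8/§10 identity at `μ = 0` with number-conserving ground-state blocks ⇒
  `c − Σ‖aₖ‖ + (Σ_σ μ_σ)(ρ/2 − ν) ≤ (1/32) Σ_g Re (α_g ω)(Xw)` for every density-`ρ` minimiser `ω` (`0 < ρ < 2`): each flip-twisted
  transform is again a density-`ρ` minimiser (density and `e^{src}` are orbit invariants), hence a ground state for some `μ_g`.
* §3 node shapes on the canonical class: ENERGY (`… ≤ e^{src}_{0,h}(ω)`), PAIR MAX / MIN (`2 Re ω(P₀^d)`), and the cap-row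
  discharge from a canonical cap `∃ σ TI, ρ(σ) = ρ, e^{src}_{0,h}(σ) ≤ u` (the cell's `exists_canonicalClass_sourced_le_…` nodes).

HONEST FRAMING (cell hubbard-cq): soundness theorems; no certificate, no number, no order parameter, no phase word (a bound at
fixed `h > 0` is a finite-field response, W1). NOT licensed on the canonical class: `eom`/`kkt` rows on CHARGED words (they see the
unknown `μ`), `S^z`-charged rows. Everything is PROVED; no definition, no named fact, no `sorry`. Tree search:
`lean search 'commute_totalNumber_fermionEmbed|kkt_canonical'` — nothing; REUSED `totalNumber_eq_fermionEmbed_add_sum`,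
`commute_outsideNumber_fermionEmbed`, `exists_isGroundState_hubbardTTPrimeSourced_of_canonicalMinimiser`,
`re_sum_twistedFlipAct_expect_ge_of_sourced_certificate`, `re_map_kktForm_nonneg`, `pairSourceWindowHamiltonianTT'_eq`.

References: O. Bratteli, A. Kishimoto, D. W. Robinson, Commun. Math. Phys. 64 (1978) 41, Thm. 2 [cite: BratteliKishimotoRobinson1978, Thm. 2];
D. Ruelle, *Statistical Mechanics* (1969) §3.4 [cite: Ruelle1969, §3.4]; J. Wang et al., PRX 14 (2024) 031006, §III [cite: WangEtAl2024, §III];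
M. Araújo et al., arXiv:2311.18707, §3.2 Prop. 11 [cite: AraujoEtAl2023, §3.2 Prop. 11]; T. Koma, H. Tasaki, J. Stat. Phys. 76 (1994) 745, §1
[cite: KomaTasaki1994, §1]; O. Bratteli, D. W. Robinson, *OAQSM 2* (1997) §6.2.4 [cite: BratteliRobinsonII1997, §6.2.4].
-/

noncomputable section

namespace Literature.MathematicalPhysics.QuantumLattice

open Matrix Finset Complex HubbardWave0 Literature.Probability.LatticeModels Set
open Literature.MathematicalPhysics.QuantumManyBody.StateRelaxation
open scoped ComplexOrder BigOperators

/-! ## §1 Number-conserving words: the chemical potential drops out of the window rows -/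

section NumberConserving

variable {Λ Λ' : Finset (Site 2)}

/-- **A word commuting with the particle number of its support commutes with the particle number of every larger window**:
`N_{Λ'} = Γ(N_Λ) + N_{Λ'∖Λ}` and the outside number commutes with `𝔄_Λ`. [cite: BratteliRobinsonII1997, §6.2.4] -/
theorem commute_totalNumber_fermionEmbed_incl_of_commute (hΛ : Λ ⊆ Λ') {B : FermionOp Λ}
    (hB : Commute (totalNumber : FermionOp Λ) B) :
    Commute (totalNumber : FermionOp Λ') (fermionEmbed (PolySite.incl hΛ) B) := by
  rw [totalNumber_eq_fermionEmbed_add_sum hΛ]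
  exact (hB.map (fermionEmbed (PolySite.incl hΛ))).add_left (commute_outsideNumber_fermionEmbed hΛ B)

/-- **`[H^{src,tt'}_{Λ'}(μ), B̃] = [H^{src,tt'}_{Λ'}(μ₀), B̃]` for `B̃` commuting with `N_{Λ'}`**: the chemical-potential term
`−μ N_{Λ'}` of the window Hamiltonian drops out of commutators with number-conserving words. [cite: KomaTasaki1994, §1]
[cite: BratteliRobinsonII1997, §6.2.4] -/
theorem pairSourceWindowHamiltonianTT'_commutator_eq_of_commute_totalNumber (g : Site 2 → ℝ) (Λ' : Finset (Site 2))
    (tp U μ μ₀ h : ℝ) {A : FermionOp Λ'} (hA : Commute (totalNumber : FermionOp Λ') A) :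
    pairSourceWindowHamiltonianTT' g Λ' tp U μ h * A - A * pairSourceWindowHamiltonianTT' g Λ' tp U μ h =
      pairSourceWindowHamiltonianTT' g Λ' tp U μ₀ h * A - A * pairSourceWindowHamiltonianTT' g Λ' tp U μ₀ h := by
  rw [pairSourceWindowHamiltonianTT'_eq, pairSourceWindowHamiltonianTT'_eq]
  simp only [sub_mul, mul_sub, Matrix.smul_mul, Matrix.mul_smul, hA.eq]
  abel

namespace InfVolFermionState

variable {ω : InfVolFermionState 2} {t' U μ h : ℝ}

/-- **`eom` row on a number-conserving word, at any window chemical potential**: for a ground state `ω` of `Φ − μn − hP_d`,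
`B ∈ 𝔄_Λ` with `Commute N_Λ B`, `thicken Λ 1 ⊆ Λ'`, and any `μ₀`: `ω(H^{src,tt'}_{Λ'}(μ₀) B̃ − B̃ H^{src,tt'}_{Λ'}(μ₀)) = 0`.
[cite: BratteliRobinsonII1997, Prop. 5.3.19] [cite: KomaTasaki1994, §1] -/
theorem IsGroundState.expect_commutator_pairSourceWindowHamiltonianTT'_eq_zero_of_commute_totalNumber
    (hgs : ω.IsGroundState (hubbardTTPrimeSourcedInteraction 1 t' U μ dWaveFormFactor h) 1) (μ₀ : ℝ)
    {Λ Λ' : Finset (Site 2)} (hΛ : Λ ⊆ Λ') (h8 : thicken Λ 1 ⊆ Λ') {B : FermionOp Λ}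
    (hB : Commute (totalNumber : FermionOp Λ) B) :
    ω.expect Λ' (pairSourceWindowHamiltonianTT' dWaveFormFactor Λ' t' U μ₀ h * fermionEmbed (PolySite.incl hΛ) B -
      fermionEmbed (PolySite.incl hΛ) B * pairSourceWindowHamiltonianTT' dWaveFormFactor Λ' t' U μ₀ h) = 0 := by
  rw [pairSourceWindowHamiltonianTT'_commutator_eq_of_commute_totalNumber dWaveFormFactor Λ' t' U μ₀ μ h
    (commute_totalNumber_fermionEmbed_incl_of_commute hΛ hB)]
  exact hgs.expect_commutator_pairSourceWindowHamiltonianTT'_eq_zero hΛ h8 B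

/-- **The `eom` BLOCK on number-conserving words vanishes**, at any window chemical potential `μ₀`.
[cite: BratteliRobinsonII1997, Prop. 5.3.19] -/
theorem IsGroundState.expect_sum_commutator_pairSourceWindowHamiltonianTT'_eq_zero_of_commute_totalNumber
    (hgs : ω.IsGroundState (hubbardTTPrimeSourcedInteraction 1 t' U μ dWaveFormFactor h) 1) (μ₀ : ℝ)
    {Λ Λ' : Finset (Site 2)} (hΛ : Λ ⊆ Λ') (h8 : thicken Λ 1 ⊆ Λ') {κ' : Type*} (s : Finset κ') (B : κ' → FermionOp Λ)
    (hB : ∀ k ∈ s, Commute (totalNumber : FermionOp Λ) (B k)) :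
    ω.expect Λ' (∑ k ∈ s,
      (pairSourceWindowHamiltonianTT' dWaveFormFactor Λ' t' U μ₀ h * fermionEmbed (PolySite.incl hΛ) (B k) -
        fermionEmbed (PolySite.incl hΛ) (B k) * pairSourceWindowHamiltonianTT' dWaveFormFactor Λ' t' U μ₀ h)) = 0 := by
  rw [map_sum]
  exact Finset.sum_eq_zero fun k hk =>
    hgs.expect_commutator_pairSourceWindowHamiltonianTT'_eq_zero_of_commute_totalNumber μ₀ hΛ h8 (hB k hk)

/-- **Bratteli–Robinson inequality on a number-conserving word, at any window chemical potential**: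
`0 ≤ Re ω(Ã⋆ (H^{src,tt'}_{Λ'}(μ₀) Ã − Ã H^{src,tt'}_{Λ'}(μ₀)))` for `A ∈ 𝔄_Λ` with `Commute N_Λ A`.
[cite: BratteliKishimotoRobinson1978, Thm. 2] [cite: KomaTasaki1994, §1] -/
theorem IsGroundState.re_expect_conj_commutator_pairSourceWindowHamiltonianTT'_nonneg_of_commute_totalNumber
    (hgs : ω.IsGroundState (hubbardTTPrimeSourcedInteraction 1 t' U μ dWaveFormFactor h) 1) (μ₀ : ℝ)
    {Λ Λ' : Finset (Site 2)} (hΛ : Λ ⊆ Λ') (h8 : thicken Λ 1 ⊆ Λ') {A : FermionOp Λ}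
    (hA : Commute (totalNumber : FermionOp Λ) A) :
    0 ≤ (ω.expect Λ' ((fermionEmbed (PolySite.incl hΛ) A)ᴴ *
      (pairSourceWindowHamiltonianTT' dWaveFormFactor Λ' t' U μ₀ h * fermionEmbed (PolySite.incl hΛ) A -
        fermionEmbed (PolySite.incl hΛ) A * pairSourceWindowHamiltonianTT' dWaveFormFactor Λ' t' U μ₀ h))).re := by
  rw [pairSourceWindowHamiltonianTT'_commutator_eq_of_commute_totalNumber dWaveFormFactor Λ' t' U μ₀ μ h
    (commute_totalNumber_fermionEmbed_incl_of_commute hΛ hA)]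
  exact hgs.re_expect_conj_commutator_pairSourceWindowHamiltonianTT'_nonneg hΛ h8 A

/-- **The `kkt` block on number-conserving generators is nonnegative**, at any window chemical potential `μ₀`: for
`G ⪰ 0` and a finite family `Bk_b ∈ 𝔄_Λ` with `Commute N_Λ (Bk_b)` for every `b`, `0 ≤ Re ω(kktForm H^{src,tt'}_{Λ'}(μ₀) G B̃k)`
(every linear combination of the generators is number conserving, so the one-generator inequality holds on their span).
[cite: AraujoEtAl2023, §3.2 Prop. 11] [cite: BratteliKishimotoRobinson1978, Thm. 2] -/
theorem IsGroundState.re_expect_kktForm_pairSourceWindowHamiltonianTT'_nonneg_of_commute_totalNumber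
    (hgs : ω.IsGroundState (hubbardTTPrimeSourcedInteraction 1 t' U μ dWaveFormFactor h) 1) (μ₀ : ℝ)
    {Λ Λ' : Finset (Site 2)} (hΛ : Λ ⊆ Λ') (h8 : thicken Λ 1 ⊆ Λ') {β : Type*} [Fintype β] [DecidableEq β]
    {G : Matrix β β ℂ} (hG : G.PosSemidef) (Bk : β → FermionOp Λ) (hBk : ∀ b, Commute (totalNumber : FermionOp Λ) (Bk b)) :
    0 ≤ (ω.expect Λ' (kktForm (pairSourceWindowHamiltonianTT' dWaveFormFactor Λ' t' U μ₀ h) G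
      (fun b => fermionEmbed (PolySite.incl hΛ) (Bk b)))).re := by
  refine re_map_kktForm_nonneg (ω.expect Λ') _ hG _ fun w => ?_
  have hsum : ∑ j, w j • fermionEmbed (PolySite.incl hΛ) (Bk j) = fermionEmbed (PolySite.incl hΛ) (∑ j, w j • Bk j) := by
    rw [map_sum]
    exact Finset.sum_congr rfl fun j _ => (fermionEmbed_smul _ _ _).symm
  have hC : Commute (totalNumber : FermionOp Λ) (∑ j, w j • Bk j) :=
    Commute.sum_right _ _ _ fun j _ => (hBk j).smul_right (w j)
  rw [hsum, Matrix.star_eq_conjTranspose]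
  exact hgs.re_expect_conj_commutator_pairSourceWindowHamiltonianTT'_nonneg_of_commute_totalNumber μ₀ hΛ h8 hC

end InfVolFermionState

end NumberConserving

/-! ## §2 The orbit form on the canonical class -/

namespace InfVolFermionState

variable {ω : InfVolFermionState 2} {t' U h ρ : ℝ}

/-- **A flip-twisted transform of a density-`ρ` minimiser of the sourced energy is a density-`ρ` minimiser**
(translation invariance, the density and `e^{src}` are orbit invariants). [cite: BratteliKishimotoRobinson1978, Thm. 2 (condition 2)] -/
theorem IsTranslationInvariant.twistedFlipAct_canonicalMinimiser (hω : ω.IsTranslationInvariant) (hρ : ω.density = ρ)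
    {μ : ℝ} (hmin : ∀ σ : InfVolFermionState 2, σ.IsTranslationInvariant → σ.density = ρ →
      ω.meanEnergy (hubbardTTPrimeSourcedInteraction 1 t' U μ dWaveFormFactor h) 1 ≤
        σ.meanEnergy (hubbardTTPrimeSourcedInteraction 1 t' U μ dWaveFormFactor h) 1) (g : TwistFlipIndex) :
    (ω.twistedFlipAct g).IsTranslationInvariant ∧ (ω.twistedFlipAct g).density = ρ ∧
      ∀ σ : InfVolFermionState 2, σ.IsTranslationInvariant → σ.density = ρ →
        (ω.twistedFlipAct g).meanEnergy (hubbardTTPrimeSourcedInteraction 1 t' U μ dWaveFormFactor h) 1 ≤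
          σ.meanEnergy (hubbardTTPrimeSourcedInteraction 1 t' U μ dWaveFormFactor h) 1 := by
  refine ⟨hω.twistedFlipAct g, (twistedFlipAct_density g ω).trans hρ, fun σ hσ hσρ => ?_⟩
  rw [hω.meanEnergy_hubbardTTPrimeSourced_twistedFlipAct g 1 t' U μ h]
  exact hmin σ hσ hσρ

/-- **Sourced window certificate at `μ = 0` WITH ground-state rows on NUMBER-CONSERVING words ⇒ bound on the orbit mean of the
objective for every density-`ρ` MINIMISER of the sourced energy** (`0 < ρ < 2`). The identity is that of
`DWaveSourceGSClassWindowCertificate` at `μ = 0` (`E^{src}_h = (hubbardTTPrimeSourcedInteraction 1 t' U 0 dWaveFormFactor h).meanEnergyObs 1`,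
`H₀ = pairSourceWindowHamiltonianTT' dWaveFormFactor Λ' t' U 0 h`), with `Commute N_Λ (B k)` for every `eom` word and `Commute N_Λ (Bk b)`
for every `kkt` generator; filling rows `μ_σ (n_{0σ} − ν·1)`, cap row `κ⁺ (u·1 − Γ E^{src}_h)` (premise on `ω`), floor row
`κ⁻ (Γ E^{tt'} − ℓ·1)` (premise on the translation-invariant states of density `ρ`). Conclusion:
`c − Σ‖aₖ‖ + (Σ_σ μ_σ)(ρ/2 − ν) ≤ (1/32) Σ_g Re (α_g ω)(Xw)`. Each transform `α_g ω` is a density-`ρ` minimiser, hence (Ruelle +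
Bratteli–Kishimoto–Robinson) a ground state of `Φ − μ_g n − hP_d` for some `μ_g`, in which the number-conserving `eom` block vanishes
and the `kkt` block is `≥ 0` whatever `μ_g` is. [cite: BratteliKishimotoRobinson1978, Thm. 2] [cite: Ruelle1969, §3.4]
[cite: WangEtAl2024, §III] [cite: AraujoEtAl2023, §3.2 Prop. 11] -/
theorem IsTranslationInvariant.re_sum_twistedFlipAct_expect_ge_of_sourced_certificate_kkt_canonical
    (hω : ω.IsTranslationInvariant) (hρ : ω.density = ρ) (hρ0 : 0 < ρ) (hρ2 : ρ < 2)
    (hmin : ∀ σ : InfVolFermionState 2, σ.IsTranslationInvariant → σ.density = ρ →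
      ω.meanEnergy (hubbardTTPrimeSourcedInteraction 1 t' U 0 dWaveFormFactor h) 1 ≤
        σ.meanEnergy (hubbardTTPrimeSourcedInteraction 1 t' U 0 dWaveFormFactor h) 1)
    {Λ Λ' : Finset (Site 2)} (hΛ : Λ ⊆ Λ') (h8 : thicken Λ 1 ⊆ Λ') (h0 : thicken ({0} : Finset (Site 2)) 1 ⊆ Λ')
    (hz : (0 : Site 2) ∈ Λ')
    (Xw : FermionOp Λ') (κp κm u lo : ℝ) (μc : Fin 2 → ℝ) (ν : ℝ)
    (hcap : κp * ω.meanEnergy (hubbardTTPrimeSourcedInteraction 1 t' U 0 dWaveFormFactor h) 1 ≤ κp * u)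
    (hlo : ∀ σ : InfVolFermionState 2, σ.IsTranslationInvariant → σ.density = ω.density →
      κm * lo ≤ κm * σ.meanEnergy (hubbardTTPrimeFermionInteraction 1 t' U) 1)
    {m : Type*} [Fintype m] [DecidableEq m] {Λm : Matrix m m ℂ} (hΛm : Λm.PosSemidef) (O : m → FermionOp Λ')
    {κ' : Type*} (s : Finset κ') (B : κ' → FermionOp Λ) (hB : ∀ k ∈ s, Commute (totalNumber : FermionOp Λ) (B k))
    {ι : Type*} (tt : Finset ι) (γ : ι → DihedralGroup 4) (wv : ι → Site 2) (fl mt : ι → Fin 2)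
    (hsh : ∀ l, d4ShiftSet (γ l) (wv l) Λ ⊆ Λ') (bb : ι → ℂ) (yw : ι → List (Orb (PolySite Λ) × Bool))
    {δ : Type*} (ah : Finset δ) (dc : δ → ℝ) (V : δ → FermionOp Λ')
    {κ'' : Type*} (w : Finset κ'') (a : κ'' → ℂ) (word : κ'' → List (Orb (PolySite Λ') × Bool))
    {β : Type*} [Fintype β] [DecidableEq β] {G : Matrix β β ℂ} (hG : G.PosSemidef) (Bk : β → FermionOp Λ)
    (hBk : ∀ b, Commute (totalNumber : FermionOp Λ) (Bk b)) {c : ℝ}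
    (hcert : Xw - (c : ℂ) • (1 : FermionOp Λ') -
        ∑ σ : Fin 2, ((μc σ : ℝ) : ℂ) • (nAt 0 hz σ - ((ν : ℝ) : ℂ) • (1 : FermionOp Λ')) -
        ((κp : ℝ) : ℂ) • (((u : ℝ) : ℂ) • (1 : FermionOp Λ') -
          fermionEmbed (PolySite.incl h0) ((hubbardTTPrimeSourcedInteraction 1 t' U 0 dWaveFormFactor h).meanEnergyObs 1)) -
        ((κm : ℝ) : ℂ) • (fermionEmbed (PolySite.incl h0) ((hubbardTTPrimeFermionInteraction 1 t' U).meanEnergyObs 1) -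
          ((lo : ℝ) : ℂ) • (1 : FermionOp Λ')) =
      gramForm Λm O +
        (∑ k ∈ s, (pairSourceWindowHamiltonianTT' dWaveFormFactor Λ' t' U 0 h * fermionEmbed (PolySite.incl hΛ) (B k) -
            fermionEmbed (PolySite.incl hΛ) (B k) * pairSourceWindowHamiltonianTT' dWaveFormFactor Λ' t' U 0 h) +
          ∑ l ∈ tt, bb l • (gaugePhase (twistFlipExp (γ l) (fl l) (mt l)) (yw l) •
              fermionEmbed (PolySite.incl (hsh l))
                (fermionEmbed (PolySite.d4Emb (γ l) (wv l) Λ) (spinSwapIter (fl l).val (ladderWord (yw l)))) -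
            fermionEmbed (PolySite.incl hΛ) (ladderWord (yw l)))) +
        (∑ m' ∈ ah, ((dc m' : ℝ) : ℂ) • ((V m')ᴴ - V m') + ∑ k ∈ w, a k • ladderWord (word k)) +
        kktForm (pairSourceWindowHamiltonianTT' dWaveFormFactor Λ' t' U 0 h) G
          (fun b' => fermionEmbed (PolySite.incl hΛ) (Bk b'))) :
    c - ∑ k ∈ w, ‖a k‖ + (∑ σ : Fin 2, μc σ) * (ω.density / 2 - ν) ≤
      (∑ g : TwistFlipIndex, ((ω.twistedFlipAct g).expect Λ' Xw).re) / 32 := by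
  -- the ground-state blocks
  set E : FermionOp Λ' := ∑ k ∈ s,
    (pairSourceWindowHamiltonianTT' dWaveFormFactor Λ' t' U 0 h * fermionEmbed (PolySite.incl hΛ) (B k) -
      fermionEmbed (PolySite.incl hΛ) (B k) * pairSourceWindowHamiltonianTT' dWaveFormFactor Λ' t' U 0 h) with hE
  set K : FermionOp Λ' := kktForm (pairSourceWindowHamiltonianTT' dWaveFormFactor Λ' t' U 0 h) G
    (fun b' => fermionEmbed (PolySite.incl hΛ) (Bk b')) with hK
  set D : FermionOp Λ' := ∑ l ∈ tt, bb l • (gaugePhase (twistFlipExp (γ l) (fl l) (mt l)) (yw l) •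
      fermionEmbed (PolySite.incl (hsh l))
        (fermionEmbed (PolySite.d4Emb (γ l) (wv l) Λ) (spinSwapIter (fl l).val (ladderWord (yw l)))) -
    fermionEmbed (PolySite.incl hΛ) (ladderWord (yw l))) with hD
  set R : FermionOp Λ' := ∑ m' ∈ ah, ((dc m' : ℝ) : ℂ) • ((V m')ᴴ - V m') + ∑ k ∈ w, a k • ladderWord (word k) with hR
  set N : FermionOp Λ' := ∑ σ : Fin 2, ((μc σ : ℝ) : ℂ) • (nAt 0 hz σ - ((ν : ℝ) : ℂ) • (1 : FermionOp Λ')) with hN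
  set Cp : FermionOp Λ' := ((κp : ℝ) : ℂ) • (((u : ℝ) : ℂ) • (1 : FermionOp Λ') -
    fermionEmbed (PolySite.incl h0) ((hubbardTTPrimeSourcedInteraction 1 t' U 0 dWaveFormFactor h).meanEnergyObs 1)) with hCp
  set Cm : FermionOp Λ' := ((κm : ℝ) : ℂ) • (fermionEmbed (PolySite.incl h0)
    ((hubbardTTPrimeFermionInteraction 1 t' U).meanEnergyObs 1) - ((lo : ℝ) : ℂ) • (1 : FermionOp Λ')) with hCm
  have hcert' : (Xw - E - K) - (c : ℂ) • (1 : FermionOp Λ') - N - Cp - Cm = gramForm Λm O + D + R := by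
    have h1 : (Xw - E - K) - (c : ℂ) • (1 : FermionOp Λ') - N - Cp - Cm =
        (Xw - (c : ℂ) • (1 : FermionOp Λ') - N - Cp - Cm) - E - K := by abel
    rw [h1, hcert]
    abel
  have hmain := hω.re_sum_twistedFlipAct_expect_ge_of_sourced_certificate t' U 0 h hΛ h0 hz (Xw - E - K) κp κm u lo μc ν hcap
    hlo hΛm O tt γ wv fl mt hsh bb yw ah dc V w a word hcert'
  -- each transform is a density-`ρ` minimiser, hence a ground state for some chemical potential
  have hg : ∀ g : TwistFlipIndex,
      ((ω.twistedFlipAct g).expect Λ' (Xw - E - K)).re ≤ ((ω.twistedFlipAct g).expect Λ' Xw).re := by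
    intro g
    obtain ⟨hTg, hρg, hming⟩ := hω.twistedFlipAct_canonicalMinimiser hρ hmin g
    obtain ⟨μg, -, hgs⟩ := exists_isGroundState_hubbardTTPrimeSourced_of_canonicalMinimiser hTg hρg hρ0 hρ2 hming
    have hE0 : (ω.twistedFlipAct g).expect Λ' E = 0 :=
      hgs.expect_sum_commutator_pairSourceWindowHamiltonianTT'_eq_zero_of_commute_totalNumber 0 hΛ h8 s B hB
    have hK0 : 0 ≤ ((ω.twistedFlipAct g).expect Λ' K).re :=
      hgs.re_expect_kktForm_pairSourceWindowHamiltonianTT'_nonneg_of_commute_totalNumber 0 hΛ h8 hG Bk hBk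
    rw [map_sub, map_sub, hE0, sub_zero, Complex.sub_re]
    linarith
  have hsum := Finset.sum_le_sum fun g (_ : g ∈ (Finset.univ : Finset TwistFlipIndex)) => hg g
  exact hmain.trans (div_le_div_of_nonneg_right hsum (by norm_num))

/-! ## §3 The node shapes on the canonical class -/

/-- **Cap-row discharge on the canonical class**: a canonical cap «some translation-invariant `σ` of density `ρ` has
`e^{src}_{0,h}(σ) ≤ u`» (a cluster state of exact / bracketed density) and `κ⁺ ≥ 0` give `κ⁺ e^{src}_{0,h}(ω) ≤ κ⁺ u` for every
density-`ρ` minimiser `ω`. [cite: Ruelle1969, §3.4] -/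
theorem mul_meanEnergy_sourced_le_of_canonicalCap
    (hmin : ∀ σ : InfVolFermionState 2, σ.IsTranslationInvariant → σ.density = ρ →
      ω.meanEnergy (hubbardTTPrimeSourcedInteraction 1 t' U 0 dWaveFormFactor h) 1 ≤
        σ.meanEnergy (hubbardTTPrimeSourcedInteraction 1 t' U 0 dWaveFormFactor h) 1)
    {κp u : ℝ} (hκ : 0 ≤ κp)
    (hcapW : ∃ σ : InfVolFermionState 2, σ.IsTranslationInvariant ∧ σ.density = ρ ∧
      σ.meanEnergy (hubbardTTPrimeSourcedInteraction 1 t' U 0 dWaveFormFactor h) 1 ≤ u) :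
    κp * ω.meanEnergy (hubbardTTPrimeSourcedInteraction 1 t' U 0 dWaveFormFactor h) 1 ≤ κp * u := by
  obtain ⟨σ, hσ, hσρ, hσu⟩ := hcapW
  exact mul_le_mul_of_nonneg_left ((hmin σ hσ hσρ).trans hσu) hκ

/-- **ENERGY objective on the canonical class** (`Xw = Γ E^{src}_{0,h}`): `c − Σ‖aₖ‖ + (Σ_σ μ_σ)(ρ/2 − ν) ≤ e^{src}_{0,h}(ω)` for every
density-`ρ` minimiser `ω` (filling rows typically at `ν = ρ/2`, where the filling term vanishes).
[cite: WangEtAl2024, §III] [cite: BratteliKishimotoRobinson1978, Thm. 2] -/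
theorem IsTranslationInvariant.le_meanEnergy_sourced_of_twistedFlip_certificate_kkt_canonical
    (hω : ω.IsTranslationInvariant) (hρ : ω.density = ρ) (hρ0 : 0 < ρ) (hρ2 : ρ < 2)
    (hmin : ∀ σ : InfVolFermionState 2, σ.IsTranslationInvariant → σ.density = ρ →
      ω.meanEnergy (hubbardTTPrimeSourcedInteraction 1 t' U 0 dWaveFormFactor h) 1 ≤
        σ.meanEnergy (hubbardTTPrimeSourcedInteraction 1 t' U 0 dWaveFormFactor h) 1)
    {Λ Λ' : Finset (Site 2)} (hΛ : Λ ⊆ Λ') (h8 : thicken Λ 1 ⊆ Λ') (h0 : thicken ({0} : Finset (Site 2)) 1 ⊆ Λ')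
    (hz : (0 : Site 2) ∈ Λ') (κp κm u lo : ℝ) (μc : Fin 2 → ℝ) (ν : ℝ)
    (hcap : κp * ω.meanEnergy (hubbardTTPrimeSourcedInteraction 1 t' U 0 dWaveFormFactor h) 1 ≤ κp * u)
    (hlo : ∀ σ : InfVolFermionState 2, σ.IsTranslationInvariant → σ.density = ω.density →
      κm * lo ≤ κm * σ.meanEnergy (hubbardTTPrimeFermionInteraction 1 t' U) 1)
    {m : Type*} [Fintype m] [DecidableEq m] {Λm : Matrix m m ℂ} (hΛm : Λm.PosSemidef) (O : m → FermionOp Λ')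
    {κ' : Type*} (s : Finset κ') (B : κ' → FermionOp Λ) (hB : ∀ k ∈ s, Commute (totalNumber : FermionOp Λ) (B k))
    {ι : Type*} (tt : Finset ι) (γ : ι → DihedralGroup 4) (wv : ι → Site 2) (fl mt : ι → Fin 2)
    (hsh : ∀ l, d4ShiftSet (γ l) (wv l) Λ ⊆ Λ') (bb : ι → ℂ) (yw : ι → List (Orb (PolySite Λ) × Bool))
    {δ : Type*} (ah : Finset δ) (dc : δ → ℝ) (V : δ → FermionOp Λ')
    {κ'' : Type*} (w : Finset κ'') (a : κ'' → ℂ) (word : κ'' → List (Orb (PolySite Λ') × Bool))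
    {β : Type*} [Fintype β] [DecidableEq β] {G : Matrix β β ℂ} (hG : G.PosSemidef) (Bk : β → FermionOp Λ)
    (hBk : ∀ b, Commute (totalNumber : FermionOp Λ) (Bk b)) {c : ℝ}
    (hcert : fermionEmbed (PolySite.incl h0) ((hubbardTTPrimeSourcedInteraction 1 t' U 0 dWaveFormFactor h).meanEnergyObs 1) -
        (c : ℂ) • (1 : FermionOp Λ') -
        ∑ σ : Fin 2, ((μc σ : ℝ) : ℂ) • (nAt 0 hz σ - ((ν : ℝ) : ℂ) • (1 : FermionOp Λ')) -
        ((κp : ℝ) : ℂ) • (((u : ℝ) : ℂ) • (1 : FermionOp Λ') -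
          fermionEmbed (PolySite.incl h0) ((hubbardTTPrimeSourcedInteraction 1 t' U 0 dWaveFormFactor h).meanEnergyObs 1)) -
        ((κm : ℝ) : ℂ) • (fermionEmbed (PolySite.incl h0) ((hubbardTTPrimeFermionInteraction 1 t' U).meanEnergyObs 1) -
          ((lo : ℝ) : ℂ) • (1 : FermionOp Λ')) =
      gramForm Λm O +
        (∑ k ∈ s, (pairSourceWindowHamiltonianTT' dWaveFormFactor Λ' t' U 0 h * fermionEmbed (PolySite.incl hΛ) (B k) -
            fermionEmbed (PolySite.incl hΛ) (B k) * pairSourceWindowHamiltonianTT' dWaveFormFactor Λ' t' U 0 h) +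
          ∑ l ∈ tt, bb l • (gaugePhase (twistFlipExp (γ l) (fl l) (mt l)) (yw l) •
              fermionEmbed (PolySite.incl (hsh l))
                (fermionEmbed (PolySite.d4Emb (γ l) (wv l) Λ) (spinSwapIter (fl l).val (ladderWord (yw l)))) -
            fermionEmbed (PolySite.incl hΛ) (ladderWord (yw l)))) +
        (∑ m' ∈ ah, ((dc m' : ℝ) : ℂ) • ((V m')ᴴ - V m') + ∑ k ∈ w, a k • ladderWord (word k)) +
        kktForm (pairSourceWindowHamiltonianTT' dWaveFormFactor Λ' t' U 0 h) G
          (fun b' => fermionEmbed (PolySite.incl hΛ) (Bk b'))) :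
    c - ∑ k ∈ w, ‖a k‖ + (∑ σ : Fin 2, μc σ) * (ω.density / 2 - ν) ≤
      ω.meanEnergy (hubbardTTPrimeSourcedInteraction 1 t' U 0 dWaveFormFactor h) 1 := by
  have hmain := hω.re_sum_twistedFlipAct_expect_ge_of_sourced_certificate_kkt_canonical hρ hρ0 hρ2 hmin hΛ h8 h0 hz _ κp κm
    u lo μc ν hcap hlo hΛm O s B hB tt γ wv fl mt hsh bb yw ah dc V w a word hG Bk hBk hcert
  have hE : ∀ g : TwistFlipIndex, ((ω.twistedFlipAct g).expect Λ'
      (fermionEmbed (PolySite.incl h0) ((hubbardTTPrimeSourcedInteraction 1 t' U 0 dWaveFormFactor h).meanEnergyObs 1))).re =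
      (ω.twistedFlipAct g).meanEnergy (hubbardTTPrimeSourcedInteraction 1 t' U 0 dWaveFormFactor h) 1 := fun g => by
    rw [(ω.twistedFlipAct g).compatible h0, InfVolFermionState.meanEnergy]
  simp_rw [hE, hω.sum_meanEnergy_hubbardTTPrimeSourced_twistedFlipAct] at hmain
  linarith

/-- **PAIR-AMPLITUDE MAX on the canonical class** (`Xw = −(Γ P₀^d + (Γ P₀^d)ᴴ)`):
`2 Re ω(P₀^d) ≤ −(c − Σ‖aₖ‖ + (Σ_σ μ_σ)(ρ/2 − ν))` for every density-`ρ` minimiser `ω`; a finite-`h` RESPONSE ceiling.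
[cite: KomaTasaki1994, §1] [cite: WangEtAl2024, §III] -/
theorem IsTranslationInvariant.two_mul_re_expect_localPairAt_le_of_twistedFlip_certificate_kkt_canonical
    (hω : ω.IsTranslationInvariant) (hρ : ω.density = ρ) (hρ0 : 0 < ρ) (hρ2 : ρ < 2)
    (hmin : ∀ σ : InfVolFermionState 2, σ.IsTranslationInvariant → σ.density = ρ →
      ω.meanEnergy (hubbardTTPrimeSourcedInteraction 1 t' U 0 dWaveFormFactor h) 1 ≤
        σ.meanEnergy (hubbardTTPrimeSourcedInteraction 1 t' U 0 dWaveFormFactor h) 1)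
    {Λ Λ' : Finset (Site 2)} (hΛ : Λ ⊆ Λ') (h8 : thicken Λ 1 ⊆ Λ') (h0 : thicken ({0} : Finset (Site 2)) 1 ⊆ Λ')
    (hz : (0 : Site 2) ∈ Λ') (hP : pairRegion (insert (0 : Site 2) unitSteps) 0 ⊆ Λ')
    (κp κm u lo : ℝ) (μc : Fin 2 → ℝ) (ν : ℝ)
    (hcap : κp * ω.meanEnergy (hubbardTTPrimeSourcedInteraction 1 t' U 0 dWaveFormFactor h) 1 ≤ κp * u)
    (hlo : ∀ σ : InfVolFermionState 2, σ.IsTranslationInvariant → σ.density = ω.density →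
      κm * lo ≤ κm * σ.meanEnergy (hubbardTTPrimeFermionInteraction 1 t' U) 1)
    {m : Type*} [Fintype m] [DecidableEq m] {Λm : Matrix m m ℂ} (hΛm : Λm.PosSemidef) (O : m → FermionOp Λ')
    {κ' : Type*} (s : Finset κ') (B : κ' → FermionOp Λ) (hB : ∀ k ∈ s, Commute (totalNumber : FermionOp Λ) (B k))
    {ι : Type*} (tt : Finset ι) (γ : ι → DihedralGroup 4) (wv : ι → Site 2) (fl mt : ι → Fin 2)
    (hsh : ∀ l, d4ShiftSet (γ l) (wv l) Λ ⊆ Λ') (bb : ι → ℂ) (yw : ι → List (Orb (PolySite Λ) × Bool))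
    {δ : Type*} (ah : Finset δ) (dc : δ → ℝ) (V : δ → FermionOp Λ')
    {κ'' : Type*} (w : Finset κ'') (a : κ'' → ℂ) (word : κ'' → List (Orb (PolySite Λ') × Bool))
    {β : Type*} [Fintype β] [DecidableEq β] {G : Matrix β β ℂ} (hG : G.PosSemidef) (Bk : β → FermionOp Λ)
    (hBk : ∀ b, Commute (totalNumber : FermionOp Λ) (Bk b)) {c : ℝ}
    (hcert : -(fermionEmbed (PolySite.incl hP) (localPairAt (insert (0 : Site 2) unitSteps) dWaveFormFactor 0) +
          (fermionEmbed (PolySite.incl hP) (localPairAt (insert (0 : Site 2) unitSteps) dWaveFormFactor 0))ᴴ) -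
        (c : ℂ) • (1 : FermionOp Λ') -
        ∑ σ : Fin 2, ((μc σ : ℝ) : ℂ) • (nAt 0 hz σ - ((ν : ℝ) : ℂ) • (1 : FermionOp Λ')) -
        ((κp : ℝ) : ℂ) • (((u : ℝ) : ℂ) • (1 : FermionOp Λ') -
          fermionEmbed (PolySite.incl h0) ((hubbardTTPrimeSourcedInteraction 1 t' U 0 dWaveFormFactor h).meanEnergyObs 1)) -
        ((κm : ℝ) : ℂ) • (fermionEmbed (PolySite.incl h0) ((hubbardTTPrimeFermionInteraction 1 t' U).meanEnergyObs 1) -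
          ((lo : ℝ) : ℂ) • (1 : FermionOp Λ')) =
      gramForm Λm O +
        (∑ k ∈ s, (pairSourceWindowHamiltonianTT' dWaveFormFactor Λ' t' U 0 h * fermionEmbed (PolySite.incl hΛ) (B k) -
            fermionEmbed (PolySite.incl hΛ) (B k) * pairSourceWindowHamiltonianTT' dWaveFormFactor Λ' t' U 0 h) +
          ∑ l ∈ tt, bb l • (gaugePhase (twistFlipExp (γ l) (fl l) (mt l)) (yw l) •
              fermionEmbed (PolySite.incl (hsh l))
                (fermionEmbed (PolySite.d4Emb (γ l) (wv l) Λ) (spinSwapIter (fl l).val (ladderWord (yw l)))) -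
            fermionEmbed (PolySite.incl hΛ) (ladderWord (yw l)))) +
        (∑ m' ∈ ah, ((dc m' : ℝ) : ℂ) • ((V m')ᴴ - V m') + ∑ k ∈ w, a k • ladderWord (word k)) +
        kktForm (pairSourceWindowHamiltonianTT' dWaveFormFactor Λ' t' U 0 h) G
          (fun b' => fermionEmbed (PolySite.incl hΛ) (Bk b'))) :
    2 * (ω.expect (pairRegion (insert (0 : Site 2) unitSteps) 0) (localPairAt (insert (0 : Site 2) unitSteps) dWaveFormFactor 0)).re ≤
      -(c - ∑ k ∈ w, ‖a k‖ + (∑ σ : Fin 2, μc σ) * (ω.density / 2 - ν)) := by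
  have hmain := hω.re_sum_twistedFlipAct_expect_ge_of_sourced_certificate_kkt_canonical hρ hρ0 hρ2 hmin hΛ h8 h0 hz _ κp κm
    u lo μc ν hcap hlo hΛm O s B hB tt γ wv fl mt hsh bb yw ah dc V w a word hG Bk hBk hcert
  simp_rw [map_neg, Complex.neg_re, re_expect_fermionEmbed_localPairAt_add_conjTranspose, Finset.sum_neg_distrib,
    ← Finset.mul_sum, ω.sum_re_expect_localPairAt_dWave_twistedFlipAct] at hmain
  linarith

/-- **PAIR-AMPLITUDE MIN on the canonical class** (`Xw = +(Γ P₀^d + (Γ P₀^d)ᴴ)`; the K-leg at fixed filling):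
`c − Σ‖aₖ‖ + (Σ_σ μ_σ)(ρ/2 − ν) ≤ 2 Re ω(P₀^d)` for every density-`ρ` minimiser `ω`; a finite-`h` RESPONSE floor.
[cite: KomaTasaki1994, §1] [cite: WangEtAl2024, §III] [cite: AraujoEtAl2023, §3.2 Prop. 11] -/
theorem IsTranslationInvariant.le_two_mul_re_expect_localPairAt_of_twistedFlip_certificate_kkt_canonical
    (hω : ω.IsTranslationInvariant) (hρ : ω.density = ρ) (hρ0 : 0 < ρ) (hρ2 : ρ < 2)
    (hmin : ∀ σ : InfVolFermionState 2, σ.IsTranslationInvariant → σ.density = ρ →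
      ω.meanEnergy (hubbardTTPrimeSourcedInteraction 1 t' U 0 dWaveFormFactor h) 1 ≤
        σ.meanEnergy (hubbardTTPrimeSourcedInteraction 1 t' U 0 dWaveFormFactor h) 1)
    {Λ Λ' : Finset (Site 2)} (hΛ : Λ ⊆ Λ') (h8 : thicken Λ 1 ⊆ Λ') (h0 : thicken ({0} : Finset (Site 2)) 1 ⊆ Λ')
    (hz : (0 : Site 2) ∈ Λ') (hP : pairRegion (insert (0 : Site 2) unitSteps) 0 ⊆ Λ')
    (κp κm u lo : ℝ) (μc : Fin 2 → ℝ) (ν : ℝ)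
    (hcap : κp * ω.meanEnergy (hubbardTTPrimeSourcedInteraction 1 t' U 0 dWaveFormFactor h) 1 ≤ κp * u)
    (hlo : ∀ σ : InfVolFermionState 2, σ.IsTranslationInvariant → σ.density = ω.density →
      κm * lo ≤ κm * σ.meanEnergy (hubbardTTPrimeFermionInteraction 1 t' U) 1)
    {m : Type*} [Fintype m] [DecidableEq m] {Λm : Matrix m m ℂ} (hΛm : Λm.PosSemidef) (O : m → FermionOp Λ')
    {κ' : Type*} (s : Finset κ') (B : κ' → FermionOp Λ) (hB : ∀ k ∈ s, Commute (totalNumber : FermionOp Λ) (B k))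
    {ι : Type*} (tt : Finset ι) (γ : ι → DihedralGroup 4) (wv : ι → Site 2) (fl mt : ι → Fin 2)
    (hsh : ∀ l, d4ShiftSet (γ l) (wv l) Λ ⊆ Λ') (bb : ι → ℂ) (yw : ι → List (Orb (PolySite Λ) × Bool))
    {δ : Type*} (ah : Finset δ) (dc : δ → ℝ) (V : δ → FermionOp Λ')
    {κ'' : Type*} (w : Finset κ'') (a : κ'' → ℂ) (word : κ'' → List (Orb (PolySite Λ') × Bool))
    {β : Type*} [Fintype β] [DecidableEq β] {G : Matrix β β ℂ} (hG : G.PosSemidef) (Bk : β → FermionOp Λ)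
    (hBk : ∀ b, Commute (totalNumber : FermionOp Λ) (Bk b)) {c : ℝ}
    (hcert : (fermionEmbed (PolySite.incl hP) (localPairAt (insert (0 : Site 2) unitSteps) dWaveFormFactor 0) +
          (fermionEmbed (PolySite.incl hP) (localPairAt (insert (0 : Site 2) unitSteps) dWaveFormFactor 0))ᴴ) -
        (c : ℂ) • (1 : FermionOp Λ') -
        ∑ σ : Fin 2, ((μc σ : ℝ) : ℂ) • (nAt 0 hz σ - ((ν : ℝ) : ℂ) • (1 : FermionOp Λ')) -
        ((κp : ℝ) : ℂ) • (((u : ℝ) : ℂ) • (1 : FermionOp Λ') -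
          fermionEmbed (PolySite.incl h0) ((hubbardTTPrimeSourcedInteraction 1 t' U 0 dWaveFormFactor h).meanEnergyObs 1)) -
        ((κm : ℝ) : ℂ) • (fermionEmbed (PolySite.incl h0) ((hubbardTTPrimeFermionInteraction 1 t' U).meanEnergyObs 1) -
          ((lo : ℝ) : ℂ) • (1 : FermionOp Λ')) =
      gramForm Λm O +
        (∑ k ∈ s, (pairSourceWindowHamiltonianTT' dWaveFormFactor Λ' t' U 0 h * fermionEmbed (PolySite.incl hΛ) (B k) -
            fermionEmbed (PolySite.incl hΛ) (B k) * pairSourceWindowHamiltonianTT' dWaveFormFactor Λ' t' U 0 h) +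
          ∑ l ∈ tt, bb l • (gaugePhase (twistFlipExp (γ l) (fl l) (mt l)) (yw l) •
              fermionEmbed (PolySite.incl (hsh l))
                (fermionEmbed (PolySite.d4Emb (γ l) (wv l) Λ) (spinSwapIter (fl l).val (ladderWord (yw l)))) -
            fermionEmbed (PolySite.incl hΛ) (ladderWord (yw l)))) +
        (∑ m' ∈ ah, ((dc m' : ℝ) : ℂ) • ((V m')ᴴ - V m') + ∑ k ∈ w, a k • ladderWord (word k)) +
        kktForm (pairSourceWindowHamiltonianTT' dWaveFormFactor Λ' t' U 0 h) G
          (fun b' => fermionEmbed (PolySite.incl hΛ) (Bk b'))) :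
    c - ∑ k ∈ w, ‖a k‖ + (∑ σ : Fin 2, μc σ) * (ω.density / 2 - ν) ≤
      2 * (ω.expect (pairRegion (insert (0 : Site 2) unitSteps) 0) (localPairAt (insert (0 : Site 2) unitSteps) dWaveFormFactor 0)).re := by
  have hmain := hω.re_sum_twistedFlipAct_expect_ge_of_sourced_certificate_kkt_canonical hρ hρ0 hρ2 hmin hΛ h8 h0 hz _ κp κm
    u lo μc ν hcap hlo hΛm O s B hB tt γ wv fl mt hsh bb yw ah dc V w a word hG Bk hBk hcert
  simp_rw [re_expect_fermionEmbed_localPairAt_add_conjTranspose, ← Finset.mul_sum,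
    ω.sum_re_expect_localPairAt_dWave_twistedFlipAct] at hmain
  linarith

end InfVolFermionState

end Literature.MathematicalPhysics.QuantumLattice

end
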